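import Summits.NavierStokesRegularity.NavierStokesRegularity.Theorems.HeredityAtOne.Negative.HeredityAtOneFalseOfNoSwirlCappedStageAtOne
import Literature.Analysis.FluidPDE.AxisymNoSwirlSpeedCap

/-!
# The no-swirl speed-cap lever against item 19249 `HeredityAtOne` ALONE is now FACT-FREE and has a
# NUMBER: cap constant `3` (Gallay–Šverák 2015, discharged in the tree by ns-blowup-lean2 g6, p459550)

Cell `ns-blowup`, seat `ns-blowup-refuter5` (g0), K-row K5-15. NEGATIVE-LANE support for the route item
`PalasekTowerBreakdown.HeredityAtOne` (`= HeredityAt 1`, stmt-NavierStokesRegularity-19249); additive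
twin of ns-palasek-19249-disprove / 19250-p1's `HeredityAtOneFalseOfNoSwirlCappedStageAtOne.lean`
(KJ-13 chain), which carried the two printed GS15 inputs `VelocitySupBound` (Prop. 2.6 (2.14)) and
`ImpulseConservation` (Lemma 6.4) as HYPOTHESES `hBS hI` supplying a cap constant of unknown size. Both
are theorems of the tree now and `GallaySverak2015.speedCap_three` gives the cap with the EXPLICIT
constant `3` (tree normalisation `dx = r dr dθ dz`), so:

* `isNoSwirlCapConstant_three : IsNoSwirlCapConstant 3`, `exists_isNoSwirlCapConstant_holds`;
* `not_heredityAt_of_signedNoSwirlSlice_three` — ONE registered stage at a level `k ≥ 1` of a pinned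
  (`Λ = 8`, `θ = 6/5`) rigid quiet wide design whose `τ_k`-slice is single-signed swirl-free
  (`SignedNoSwirlSlice (s.u (τ k)) M`: axisymmetric, no swirl, `0 ≤ ω_θ/r ≤ M`, `ω_θ/r` and `r²ω_θ/r`
  integrable) with `3 (∫η)^{1/4} (∫r²η)^{1/4} M^{1/2} < c₁ Y_{k+1}` refutes `HeredityAt k` — ONE
  hand-over, no named fact, no unknown constant;
* by name, `k = 1`: `heredityAtOne_false_of_signedNoSwirlSlice_three : … → ¬ HeredityAtOne` — the item
  19249 ALONE (register numerics: `c₁ = 1`, `Y₂ = N₂^{β−1}`);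
* `noSwirlCappedStageAtOne_of_three` — the witness class `NoSwirlCappedStageAtOne` (the `H` of the
  existing negative lemma) is inhabited by any such level-1 stage with `C := 3`;
* `not_signedNoSwirlSlice_of_heredity_holds` — the dichotomy of the existing file with `hBS hI` dropped
  (superseded in scope by K5-12 `HeredityFrom.no_noSwirl_slice`, which needs no sign, height or
  integrability; kept for the record with the constant).

LABEL: kernel bookkeeping; nothing constructed; the premise class is empty-in-practice (no registered
level-`≥ 1` stage is known in any class: K61 / S-RING-1 / P-RING-0…2 CLOSED) and doubly so here (a
registered level-1 slice carries speed `≥ c₁Y₁` on the core while the cap value must sit below `c₁Y₂`,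
`Y₂/Y₁ = (N₂/N₁)^{β−1}`). WHAT THIS IS NOT: not Navier–Stokes evidence either way.

References: Th. Gallay, V. Šverák, Confluentes Math. 7 (2015) 67–92, Prop. 2.6 (2.14), Lemma 5.1,
Lemma 6.4 [cite: GallaySverak2016, Prop. 2.6 (2.14), Lemma 5.1, Lemma 6.4 (arXiv pp. 8, 16, 19)];
S. Palasek, arXiv:2605.13827 §4 [cite: Palasek2026ElementaryModel, §4].
-/

noncomputable section

namespace Summit.NavierStokesRegularity.HeredityAtOneNoSwirlCap

open Set MeasureTheory
open scoped ENNReal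
open Literature.Analysis.FluidPDE
open Summit.NavierStokesRegularity.FluidComputer.PalasekTowerClayBridge
open Summit.NavierStokesRegularity.NavierStokesRegularity

/-- **`3` is a no-swirl cap constant** (`GallaySverak2015.speedCap_three`, p459550: both GS15 inputs
discharged, constant explicit in the tree's normalisation). [cite: GallaySverak2016, Prop. 2.6 (2.14), Lemma 5.1, Lemma 6.4 (arXiv pp. 8, 16, 19)] -/
theorem isNoSwirlCapConstant_three : IsNoSwirlCapConstant 3 :=
  ⟨by norm_num, GallaySverak2015.speedCap_three⟩

/-- **A cap constant exists, hypothesis-free** (`exists_isNoSwirlCapConstant` with `hBS hI` dropped).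
[cite: GallaySverak2016, Prop. 2.6 (2.14)] -/
theorem exists_isNoSwirlCapConstant_holds : ∃ C, IsNoSwirlCapConstant C :=
  ⟨3, isNoSwirlCapConstant_three⟩

/-- **ONE HAND-OVER, WITH A NUMBER**: a registered stage at a level `k ≥ 1` of a pinned rigid quiet wide
design whose `τ_k`-slice is single-signed swirl-free with
`3 · √(√((∫η)(∫r²η)) · M) < c₁ Y_{k+1}` (`η = ω_θ/r` of the slice, `0 ≤ η ≤ M`) refutes `HeredityAt k`
— no named fact, no unknown constant (`not_heredityAt_of_noSwirlCappedStage` at `C := 3`).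
[cite: GallaySverak2016, Prop. 2.6 (2.14)] [cite: Palasek2026ElementaryModel, §4] -/
theorem not_heredityAt_of_signedNoSwirlSlice_three {k : ℕ} (hk : 1 ≤ k) {S : Schedule TowerRates.wide}
    (hP : S.Pins 8 (6 / 5)) (hR : S.Rigid) (hQ : S.Quiet)
    (s : Stage 1 TowerRates.wide S (Margins.routeG TowerRates.wide) k) {M : ℝ}
    (hsl : SignedNoSwirlSlice (s.u (S.τ k)) M)
    (hlt : 3 * Real.sqrt (Real.sqrt ((∫ y, angVortQuot (s.u (S.τ k)) y) *
        ∫ y, cylRadius y ^ 2 * angVortQuot (s.u (S.τ k)) y) * M) <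
      S.c₁ * TowerRates.wide.Y (k + 1)) :
    ¬ HeredityAt k :=
  not_heredityAt_of_noSwirlCappedStage hk isNoSwirlCapConstant_three hP hR hQ s hsl hlt

/-- **Item 19249 `PalasekTowerBreakdown.HeredityAtOne` ALONE, with a number** (route decl by name): ONE
registered LEVEL-1 stage of a pinned rigid quiet wide design whose `τ₁`-slice is single-signed
swirl-free with `3 · √(√((∫η)(∫r²η)) · M) < c₁ Y₂` refutes it. No named fact. Premise
empty-in-practice. [cite: GallaySverak2016, Prop. 2.6 (2.14)] [cite: Palasek2026ElementaryModel, §4] -/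
theorem heredityAtOne_false_of_signedNoSwirlSlice_three {S : Schedule TowerRates.wide}
    (hP : S.Pins 8 (6 / 5)) (hR : S.Rigid) (hQ : S.Quiet)
    (s : Stage 1 TowerRates.wide S (Margins.routeG TowerRates.wide) 1) {M : ℝ}
    (hsl : SignedNoSwirlSlice (s.u (S.τ 1)) M)
    (hlt : 3 * Real.sqrt (Real.sqrt ((∫ y, angVortQuot (s.u (S.τ 1)) y) *
        ∫ y, cylRadius y ^ 2 * angVortQuot (s.u (S.τ 1)) y) * M) <
      S.c₁ * TowerRates.wide.Y 2) :
    ¬ Theses.PalasekTowerBreakdown.HeredityAtOne := fun h =>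
  not_heredityAt_of_signedNoSwirlSlice_three le_rfl hP hR hQ s hsl hlt (heredityAtOne_iff.1 h)

/-- **The witness class `NoSwirlCappedStageAtOne` is met with `C := 3`** by any registered level-1 stage
of a pinned rigid quiet wide design with a single-signed swirl-free `τ₁`-slice below the level-2 floor
in the explicit cap. [cite: GallaySverak2016, Prop. 2.6 (2.14)] -/
theorem noSwirlCappedStageAtOne_of_three {S : Schedule TowerRates.wide}
    (hP : S.Pins 8 (6 / 5)) (hR : S.Rigid) (hQ : S.Quiet)
    (s : Stage 1 TowerRates.wide S (Margins.routeG TowerRates.wide) 1) {M : ℝ}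
    (hsl : SignedNoSwirlSlice (s.u (S.τ 1)) M)
    (hlt : 3 * Real.sqrt (Real.sqrt ((∫ y, angVortQuot (s.u (S.τ 1)) y) *
        ∫ y, cylRadius y ^ 2 * angVortQuot (s.u (S.τ 1)) y) * M) <
      S.c₁ * TowerRates.wide.Y 2) :
    NoSwirlCappedStageAtOne :=
  ⟨3, isNoSwirlCapConstant_three, S, s, M, hP, hR, hQ, hsl, hlt⟩

/-- **Dichotomy, hypothesis-free** (`not_signedNoSwirlSlice_of_heredity` with `hBS hI` dropped): the two
heredity items jointly forbid a single-signed swirl-free integrable `τ_k`-slice on any registered stage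
at any level `k ≥ 1` of a pinned rigid quiet wide design. (Scope note: K5-12
`HeredityFrom.no_noSwirl_slice` forbids EVERY axisymmetric swirl-free slice under `HeredityFrom k₀`,
no sign / height / integrability; this form is kept for the record.)
[cite: GallaySverak2016, Prop. 2.6 (2.14)] -/
theorem not_signedNoSwirlSlice_of_heredity_holds (h₁ : HeredityAtOne) (h₂ : HeredityFrom 2)
    {S : Schedule TowerRates.wide} (hP : S.Pins 8 (6 / 5)) (hR : S.Rigid) (hQ : S.Quiet) {k : ℕ}
    (hk : 1 ≤ k) (s : Stage 1 TowerRates.wide S (Margins.routeG TowerRates.wide) k) (M : ℝ) :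
    ¬ SignedNoSwirlSlice (s.u (S.τ k)) M :=
  not_signedNoSwirlSlice_of_heredity GallaySverak2015.VelocitySupBound_holds
    GallaySverak2015.ImpulseConservation_holds h₁ h₂ hP hR hQ hk s M

end Summit.NavierStokesRegularity.HeredityAtOneNoSwirlCap

end
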